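import Literature.MathematicalPhysics.QuantumFieldTheory.Balaban1983to89.B14Eq213DetSet
import Literature.MathematicalPhysics.QuantumFieldTheory.Balaban1983to89.B5Eq118OneStroke
import Literature.MathematicalPhysics.QuantumFieldTheory.Balaban1983to89.B10StarCount
import Literature.MathematicalPhysics.QuantumFieldTheory.Balaban1983to89.LatticeFieldCalculus
import HarnessLib

/-!
# N4 — TENT ∕ BOX-FILTER INTERPOLATION (route R, stub (P) linear flat core; CARD-19200-V3-g11 §2, step N4)

Cell ym3-torus, seat ym-ust-20520-w3 g2, `--supports stmt-QuantumFields-19200 --as helper` (OWNER ruling g25 02:13:50Z).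
YM₃ on the torus T³ is a RUNG of the ladder (R3), not the Clay problem.

WHAT IS PROVED (sorry-free, NO definition; letters of record: the Setup torus `Site P j`, `PBond P j`, `Site.shift`,
`B15DeterminingSets.embIter` (centres), `B5Eq118OneStroke.iterBlockOf` (the `k`-fold block map), `LatticeFieldCalculus.grad`;
`d`-generic — `d = 3` enters the consumer only through `ℓ^{d−2} = ℓ`):

* ★ `exists_tentInterpolant (k) (hk : k ≤ P.m + P.K) (f : Site P k → ℝ) :
    ∃ ψ : Site P 0 → ℝ, (∀ y, ψ (embIter k y) = f y) ∧ Σ_{b : PBond P 0} (ψ b.tgt − ψ b.src)² ≤ ((L:ℝ)^k)^(d−2) · Σ_{c : PBond P k} (f c.tgt − f c.src)²`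
  and ★ `exists_tentInterpolant_grad` (the same with `grad c` on both sides, any `c`) — the form consumed by
  `Prop7PinnedHodgeSplit.sum_grad_sq_le_of_eq_on_support` (N3): `‖∂φ‖² ≤ ‖∂ψ‖² ≤ ℓ^{d−2}·Σ_c (δ_c φ)²`.

THE INTERPOLANT (CARD N4 verbatim): `ψ(x) = ℓ^{−d}·Σ_{r ∈ [0,ℓ)^d} f(B^k(x − h + r))`, `ℓ = L^k`, `h = ((ℓ−1)/2)·𝟙` — the `d`-fold BOX
FILTER of the block-constant extension `f ∘ iterBlockOf k` (= the multilinear tent through the centres).  Def-free: the box filter is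
written as `List.foldr` over the directions `List.finRange P.d` of the one-dimensional centred box sums
`(B_μ w)(x) = Σ_{t<ℓ} w(x + (t − (ℓ−1)/2)e_μ)`, translations being `Function.update x μ (x μ + a)` (as `Site.shift`).
(a) INTERPOLATION (`foldr_box_embIter`): `L` odd ⇒ `(embIter k y)_μ = y_μ·ℓ + (ℓ−1)/2` exactly (`val_embIter`), so the box anchored at
`embIter k y − h` IS the block `B^k(y)` and every one of its `ℓ^d` summands is `f y`.
(b) ENERGY (`sum_sq_foldr_shift_sub_le`, `…_coarse`): `B_μ` commutes with the other factors and with translations; the forward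
difference of `B_μ` TELESCOPES to the long difference `w(· + ℓe_μ) − w` (`boxSum_diff`); each remaining factor costs `ℓ²` in the square
sum (Cauchy–Schwarz + translation invariance, `sum_sq_boxSum_le`); the long difference of `f ∘ iterBlockOf k` is `f` across ONE bond of
`T^{(k)}` (`iterBlockOf_update_pow`, from `B5Eq118OneStroke.iterBlockOf_runSite`), counted `L^{kd}` times (`sum_comp_iterBlockOf`).
Constant: `ℓ^{−2d}·(ℓ²)^{d−1}·ℓ^{d} = ℓ^{d−2}` (`tent_const_le`; for `d = 1` the truncated exponent gives the weaker true bound).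
-/

set_option autoImplicit false

noncomputable section

open scoped BigOperators

namespace Summit.QuantumFields.YangMills.Theorems.Prop7TentInterpolation

open Literature.MathematicalPhysics.QuantumFieldTheory.Balaban1983to89
open Finset

variable {P : Params}

/-! ## §1 Translations of the finest torus (coordinatewise, as `Setup.Site.shift`) and the one-dimensional box sum -/

/-- the site sum is invariant under translation in one coordinate. [folklore] -/
theorem sum_translate (μ : Fin P.d) (a : ZMod (P.sitesPerDir 0)) (w : Site P 0 → ℝ) :
    ∑ x : Site P 0, w (Function.update x μ (x μ + a)) = ∑ x : Site P 0, w x := by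
  refine Fintype.sum_equiv ⟨fun x => Function.update x μ (x μ + a), fun x => Function.update x μ (x μ - a), fun x => ?_, fun x => ?_⟩ _ _
    (fun _ => rfl)
  · funext ν; by_cases hν : ν = μ
    · subst hν; simp
    · simp [hν]
  · funext ν; by_cases hν : ν = μ
    · subst hν; simp
    · simp [hν]

/-- the forward shift of `Setup` IS the translation by `1`: `x.shift μ = update x μ (x μ + 1)` (definitional). [folklore] -/
theorem shift_eq_update (x : Site P 0) (μ : Fin P.d) : x.shift μ = Function.update x μ (x μ + 1) := rfl

/-- two translations in the same coordinate compose. [folklore] -/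
theorem update_update_add (x : Site P 0) (μ : Fin P.d) (a b : ZMod (P.sitesPerDir 0)) :
    Function.update (Function.update x μ (x μ + a)) μ ((Function.update x μ (x μ + a)) μ + b) = Function.update x μ (x μ + (a + b)) := by
  funext ν; by_cases hν : ν = μ
  · subst hν; simp [add_assoc]
  · simp [hν]

/-- translations in different coordinates commute. [folklore] -/
theorem update_update_comm {μ ν : Fin P.d} (hμν : μ ≠ ν) (x : Site P 0) (a b : ZMod (P.sitesPerDir 0)) :
    Function.update (Function.update x μ (x μ + a)) ν ((Function.update x μ (x μ + a)) ν + b) =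
      Function.update (Function.update x ν (x ν + b)) μ ((Function.update x ν (x ν + b)) μ + a) := by
  funext κ
  by_cases h1 : κ = μ
  · subst h1; simp [hμν, hμν.symm]
  · by_cases h2 : κ = ν
    · subst h2; simp [h1, hμν]
    · simp [h1, h2]

/-- Cauchy–Schwarz for the one-dimensional box sum: `Σ_x (Σ_{t<ℓ} v(x + (t − h)e_μ))² ≤ ℓ²·Σ_x v(x)²`. [folklore] -/
theorem sum_sq_boxSum_le (ℓ : ℕ) (h : ZMod (P.sitesPerDir 0)) (μ : Fin P.d) (v : Site P 0 → ℝ) :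
    ∑ x : Site P 0, (∑ t : Fin ℓ, v (Function.update x μ (x μ + (((t : ℕ) : ZMod (P.sitesPerDir 0)) - h)))) ^ 2 ≤ ((ℓ : ℝ) ^ 2) * ∑ x : Site P 0, v x ^ 2 := by
  have hcs : ∀ x : Site P 0, (∑ t : Fin ℓ, v (Function.update x μ (x μ + (((t : ℕ) : ZMod (P.sitesPerDir 0)) - h)))) ^ 2 ≤ (ℓ : ℝ) * ∑ t : Fin ℓ, v (Function.update x μ (x μ + (((t : ℕ) : ZMod (P.sitesPerDir 0)) - h))) ^ 2 := by
    intro x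
    have h1 := Finset.sum_mul_sq_le_sq_mul_sq (Finset.univ : Finset (Fin ℓ)) (fun _ => (1 : ℝ)) (fun t => v (Function.update x μ (x μ + (((t : ℕ) : ZMod (P.sitesPerDir 0)) - h))))
    simpa [one_pow, Finset.card_univ, Fintype.card_fin] using h1
  calc ∑ x : Site P 0, (∑ t : Fin ℓ, v (Function.update x μ (x μ + (((t : ℕ) : ZMod (P.sitesPerDir 0)) - h)))) ^ 2
      ≤ ∑ x : Site P 0, (ℓ : ℝ) * ∑ t : Fin ℓ, v (Function.update x μ (x μ + (((t : ℕ) : ZMod (P.sitesPerDir 0)) - h))) ^ 2 := Finset.sum_le_sum fun x _ => hcs x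
    _ = (ℓ : ℝ) * ∑ t : Fin ℓ, ∑ x : Site P 0, v (Function.update x μ (x μ + (((t : ℕ) : ZMod (P.sitesPerDir 0)) - h))) ^ 2 := by rw [← Finset.mul_sum, Finset.sum_comm]
    _ = (ℓ : ℝ) * ∑ t : Fin ℓ, ∑ x : Site P 0, v x ^ 2 := by
        congr 1
        exact Finset.sum_congr rfl fun t _ => sum_translate μ _ (fun x => v x ^ 2)
    _ = ((ℓ : ℝ) ^ 2) * ∑ x : Site P 0, v x ^ 2 := by
        rw [Finset.sum_const, Finset.card_univ, Fintype.card_fin, nsmul_eq_mul]; ring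

/-- the telescoping identity: the box sum of a forward difference is the long difference,
`Σ_{t<ℓ} [v(x + (t−h+1)e_μ) − v(x + (t−h)e_μ)] = v(x + (ℓ−h)e_μ) − v(x − h e_μ)`. [folklore] -/
theorem boxSum_diff (ℓ : ℕ) (h : ZMod (P.sitesPerDir 0)) (μ : Fin P.d) (v : Site P 0 → ℝ) (x : Site P 0) :
    ∑ t : Fin ℓ, (v (Function.update x μ (x μ + (((t : ℕ) : ZMod (P.sitesPerDir 0)) - h + 1))) - v (Function.update x μ (x μ + (((t : ℕ) : ZMod (P.sitesPerDir 0)) - h)))) = v (Function.update x μ (x μ + (((ℓ : ℕ) : ZMod (P.sitesPerDir 0)) - h))) - v (Function.update x μ (x μ + ((0 : ZMod (P.sitesPerDir 0)) - h))) := by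
  have key : ∀ t : ℕ, (((t : ℕ) : ZMod (P.sitesPerDir 0)) - h + 1) = ((((t + 1 : ℕ) : ℕ) : ZMod (P.sitesPerDir 0)) - h) := by
    intro t; push_cast; ring
  simp_rw [key]
  rw [Fin.sum_univ_eq_sum_range (fun t => v (Function.update x μ (x μ + ((((t + 1 : ℕ) : ℕ) : ZMod (P.sitesPerDir 0)) - h))) - v (Function.update x μ (x μ + (((t : ℕ) : ZMod (P.sitesPerDir 0)) - h)))) ℓ]
  rw [Finset.sum_range_sub (fun t => v (Function.update x μ (x μ + (((t : ℕ) : ZMod (P.sitesPerDir 0)) - h))))]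
  simp

/-! ## §2 The box fold: translations commute with it, it is linear, its square sum grows by `ℓ²` per factor, its factors commute -/

section Fold

variable (ℓ : ℕ) (h : ZMod (P.sitesPerDir 0))

/-- one box factor commutes with a translation in ANY coordinate. [folklore] -/
theorem boxStep_translate (μ ν : Fin P.d) (a : ZMod (P.sitesPerDir 0)) (w : Site P 0 → ℝ) (x : Site P 0) :
    (∑ t : Fin ℓ, w (Function.update (Function.update x ν (x ν + a)) μ ((Function.update x ν (x ν + a)) μ + (((t : ℕ) : ZMod (P.sitesPerDir 0)) - h)))) =
      (∑ t : Fin ℓ, (fun z => w (Function.update z ν (z ν + a))) (Function.update x μ (x μ + (((t : ℕ) : ZMod (P.sitesPerDir 0)) - h)))) := by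
  refine Finset.sum_congr rfl fun t _ => ?_
  by_cases hμν : μ = ν
  · subst hμν
    simp only []
    rw [update_update_add, update_update_add, add_comm a]
  · simp only []
    rw [update_update_comm (Ne.symm hμν)]

/-- the box fold commutes with translations. [folklore] -/
theorem foldr_translate (l : List (Fin P.d)) (ν : Fin P.d) (a : ZMod (P.sitesPerDir 0)) (v : Site P 0 → ℝ) (x : Site P 0) :
    (List.foldr (fun (μ : Fin P.d) (w : Site P 0 → ℝ) (x : Site P 0) => ∑ t : Fin ℓ, w (Function.update x μ (x μ + (((t : ℕ) : ZMod (P.sitesPerDir 0)) - h)))) v l) (Function.update x ν (x ν + a)) = (List.foldr (fun (μ : Fin P.d) (w : Site P 0 → ℝ) (x : Site P 0) => ∑ t : Fin ℓ, w (Function.update x μ (x μ + (((t : ℕ) : ZMod (P.sitesPerDir 0)) - h)))) (fun z => v (Function.update z ν (z ν + a))) l) x := by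
  induction l generalizing x with
  | nil => rfl
  | cons μ l ih =>
    simp only [List.foldr_cons]
    rw [boxStep_translate ℓ h μ ν a]
    exact Finset.sum_congr rfl fun t _ => ih _

/-- the box fold is additive: fold of a difference is the difference of the folds. [folklore] -/
theorem foldr_sub (l : List (Fin P.d)) (v₁ v₂ : Site P 0 → ℝ) (x : Site P 0) :
    (List.foldr (fun (μ : Fin P.d) (w : Site P 0 → ℝ) (x : Site P 0) => ∑ t : Fin ℓ, w (Function.update x μ (x μ + (((t : ℕ) : ZMod (P.sitesPerDir 0)) - h)))) (fun z => v₁ z - v₂ z) l) x = (List.foldr (fun (μ : Fin P.d) (w : Site P 0 → ℝ) (x : Site P 0) => ∑ t : Fin ℓ, w (Function.update x μ (x μ + (((t : ℕ) : ZMod (P.sitesPerDir 0)) - h)))) v₁ l) x - (List.foldr (fun (μ : Fin P.d) (w : Site P 0 → ℝ) (x : Site P 0) => ∑ t : Fin ℓ, w (Function.update x μ (x μ + (((t : ℕ) : ZMod (P.sitesPerDir 0)) - h)))) v₂ l) x := by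
  induction l generalizing x with
  | nil => rfl
  | cons μ l ih =>
    simp only [List.foldr_cons]
    rw [← Finset.sum_sub_distrib]
    exact Finset.sum_congr rfl fun t _ => ih _

/-- the square sum of the box fold grows by `ℓ²` per factor (Cauchy–Schwarz `sum_sq_boxSum_le` iterated). [folklore] -/
theorem sum_sq_foldr_le (l : List (Fin P.d)) (v : Site P 0 → ℝ) :
    ∑ x : Site P 0, ((List.foldr (fun (μ : Fin P.d) (w : Site P 0 → ℝ) (x : Site P 0) => ∑ t : Fin ℓ, w (Function.update x μ (x μ + (((t : ℕ) : ZMod (P.sitesPerDir 0)) - h)))) v l) x) ^ 2 ≤ (((ℓ : ℝ) ^ 2) ^ l.length) * ∑ x : Site P 0, v x ^ 2 := by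
  induction l with
  | nil => simp
  | cons μ l ih =>
    simp only [List.foldr_cons, List.length_cons, pow_succ]
    calc ∑ x : Site P 0, (∑ t : Fin ℓ, (List.foldr (fun (μ : Fin P.d) (w : Site P 0 → ℝ) (x : Site P 0) => ∑ t : Fin ℓ, w (Function.update x μ (x μ + (((t : ℕ) : ZMod (P.sitesPerDir 0)) - h)))) v l) (Function.update x μ (x μ + (((t : ℕ) : ZMod (P.sitesPerDir 0)) - h)))) ^ 2
        ≤ ((ℓ : ℝ) ^ 2) * ∑ x : Site P 0, ((List.foldr (fun (μ : Fin P.d) (w : Site P 0 → ℝ) (x : Site P 0) => ∑ t : Fin ℓ, w (Function.update x μ (x μ + (((t : ℕ) : ZMod (P.sitesPerDir 0)) - h)))) v l) x) ^ 2 := sum_sq_boxSum_le ℓ h μ _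
      _ ≤ ((ℓ : ℝ) ^ 2) * ((((ℓ : ℝ) ^ 2) ^ l.length) * ∑ x : Site P 0, v x ^ 2) := mul_le_mul_of_nonneg_left ih (by positivity)
      _ = (((ℓ : ℝ) ^ 2) ^ l.length * (ℓ : ℝ) ^ 2) * ∑ x : Site P 0, v x ^ 2 := by ring

/-- two box factors commute. [folklore] -/
theorem boxStep_comm (μ ν : Fin P.d) (w : Site P 0 → ℝ) (x : Site P 0) :
    (∑ t : Fin ℓ, (fun z => (∑ t : Fin ℓ, w (Function.update z ν (z ν + (((t : ℕ) : ZMod (P.sitesPerDir 0)) - h))))) (Function.update x μ (x μ + (((t : ℕ) : ZMod (P.sitesPerDir 0)) - h)))) = (∑ t : Fin ℓ, (fun z => (∑ t : Fin ℓ, w (Function.update z μ (z μ + (((t : ℕ) : ZMod (P.sitesPerDir 0)) - h))))) (Function.update x ν (x ν + (((t : ℕ) : ZMod (P.sitesPerDir 0)) - h)))) := by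
  simp only []
  rw [Finset.sum_comm]
  refine Finset.sum_congr rfl fun s _ => Finset.sum_congr rfl fun t _ => ?_
  by_cases hμν : μ = ν
  · subst hμν
    have hc : (((t : ℕ) : ZMod (P.sitesPerDir 0)) - h) + (((s : ℕ) : ZMod (P.sitesPerDir 0)) - h) =
        (((s : ℕ) : ZMod (P.sitesPerDir 0)) - h) + (((t : ℕ) : ZMod (P.sitesPerDir 0)) - h) := add_comm _ _
    rw [update_update_add, update_update_add, hc]
  · rw [update_update_comm hμν]

/-- pulling one factor out of the box fold: for `μ ∈ l`, `fold l = B_μ ∘ fold (l.erase μ)`. [folklore] -/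
theorem foldr_eq_boxStep_erase (l : List (Fin P.d)) (μ : Fin P.d) (hμ : μ ∈ l) (v : Site P 0 → ℝ) (x : Site P 0) :
    (List.foldr (fun (μ : Fin P.d) (w : Site P 0 → ℝ) (x : Site P 0) => ∑ t : Fin ℓ, w (Function.update x μ (x μ + (((t : ℕ) : ZMod (P.sitesPerDir 0)) - h)))) v l) x = (∑ t : Fin ℓ, (List.foldr (fun (μ : Fin P.d) (w : Site P 0 → ℝ) (x : Site P 0) => ∑ t : Fin ℓ, w (Function.update x μ (x μ + (((t : ℕ) : ZMod (P.sitesPerDir 0)) - h)))) v (l.erase μ)) (Function.update x μ (x μ + (((t : ℕ) : ZMod (P.sitesPerDir 0)) - h)))) := by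
  induction l generalizing x with
  | nil => exact absurd hμ List.not_mem_nil
  | cons ν l ih =>
    by_cases hνμ : ν = μ
    · subst hνμ
      simp only [List.foldr_cons, List.erase_cons_head]
    · have hμ' : μ ∈ l := by simpa [Ne.symm hνμ] using hμ
      rw [List.erase_cons_tail (by simpa using hνμ)]
      simp only [List.foldr_cons]
      rw [Finset.sum_congr rfl (fun t _ => ih hμ' _)]
      exact boxStep_comm ℓ h ν μ _ x

end Fold

/-! ## §3 Lattice geometry: long translations move the block point; fibre sums; the centres -/

section Geometry

open B5Eq118OneStroke (iterBlockOf iterBlock mem_iterBlock card_iterBlock iterBlockOf_runSite)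
open B15DeterminingSets (embIter)

/-- translating a fine site by `L^k` steps in direction `μ` shifts its `k`-block point by one step (`B5Eq118OneStroke.iterBlockOf_runSite` at `t = 1`).
[cite: Balaban1984PropagatorsI, (1.18) p.20] -/
theorem iterBlockOf_update_pow {k : ℕ} (hk : k ≤ P.m + P.K) (x : Site P 0) (μ : Fin P.d) :
    iterBlockOf k (Function.update x μ (x μ + (((P.L ^ k : ℕ) : ℕ) : ZMod (P.sitesPerDir 0)))) = (iterBlockOf k x).shift μ := by
  have h1 := iterBlockOf_runSite k hk x μ 1
  rw [one_mul] at h1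
  have e1 : LatticeFieldCalculus.runSite x μ (P.L ^ k) = Function.update x μ (x μ + (((P.L ^ k : ℕ) : ℕ) : ZMod (P.sitesPerDir 0))) := rfl
  have e2 : LatticeFieldCalculus.runSite (iterBlockOf k x) μ 1 = (iterBlockOf k x).shift μ := by
    simp [LatticeFieldCalculus.runSite, Site.shift]
  rw [← e1, h1, e2]

/-- **fibre sum**: a function of the `k`-block point summed over the finest torus counts every block `L^{kd}` times.
[cite: Balaban1984PropagatorsI, (1.18) p.20] -/
theorem sum_comp_iterBlockOf {k : ℕ} (hk : k ≤ P.m + P.K) (G : Site P k → ℝ) :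
    ∑ x : Site P 0, G (iterBlockOf k x) = (((P.L ^ P.d) ^ k : ℕ) : ℝ) * ∑ y : Site P k, G y := by
  rw [← Finset.sum_fiberwise (Finset.univ : Finset (Site P 0)) (iterBlockOf k) (fun x => G (iterBlockOf k x)), Finset.mul_sum]
  refine Finset.sum_congr rfl fun y _ => ?_
  rw [Finset.sum_congr rfl (fun x hx => by rw [(Finset.mem_filter.1 hx).2]), Finset.sum_const]
  have hc : (Finset.univ.filter fun x : Site P 0 => iterBlockOf k x = y).card = (P.L ^ P.d) ^ k := card_iterBlock k hk y
  rw [hc, nsmul_eq_mul]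

end Geometry

/-! ## §4 The centres: exact labels of `embIter`, and the box fold of `f ∘ iterBlockOf k` interpolates `L^{kd}·f` there -/

section Centre

open B5Eq118OneStroke (iterBlockOf iterBlock mem_iterBlock mem_iterBlock_iff)
open B15DeterminingSets (embIter)

/-- exact label of the iterated centre embedding, doubled form: `2·(embIter k y)_μ + 1 = (2·y_μ + 1)·L^k` (`L` odd,
`Site.val_emb` iterated). [cite: Balaban1987RG1, (0.1) p.251] -/
theorem two_mul_val_embIter_add_one : ∀ (k : ℕ), k ≤ P.m + P.K → ∀ (y : Site P k) (μ : Fin P.d),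
    2 * ((embIter k y) μ).val + 1 = (2 * (y μ).val + 1) * P.L ^ k
  | 0, _, y, μ => by simp [embIter]
  | k + 1, hk, y, μ => by
    show 2 * ((embIter k (emb y)) μ).val + 1 = _
    rw [two_mul_val_embIter_add_one k (by omega) (emb y) μ, Site.val_emb (by omega) y μ, pow_succ]
    obtain ⟨r, hr⟩ := P.hL.1
    rw [hr, show (2 * r + 1 - 1) / 2 = r by omega]
    ring

/-- exact label of the iterated centre embedding: `(embIter k y)_μ = y_μ·L^k + (L^k − 1)/2` — the centre of the cube of side `L^k`
over `y`. [cite: Balaban1987RG1, (0.1) p.251] -/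
theorem val_embIter {k : ℕ} (hk : k ≤ P.m + P.K) (y : Site P k) (μ : Fin P.d) :
    ((embIter k y) μ).val = (y μ).val * P.L ^ k + (P.L ^ k - 1) / 2 := by
  have A : 2 * ((embIter k y) μ).val + 1 = 2 * ((y μ).val * P.L ^ k) + P.L ^ k := by
    rw [two_mul_val_embIter_add_one k hk y μ]; ring
  have hodd : P.L ^ k % 2 = 1 := Nat.odd_iff.mp (Odd.pow P.hL.1)
  generalize (y μ).val * P.L ^ k = Y at A ⊢
  generalize P.L ^ k = ℓ at A hodd ⊢
  omega

/-- label of a point of the centred box: if `z_μ = y_μ·L^k + (L^k−1)/2` then `(z + (t − (L^k−1)/2)e_μ)_μ = y_μ·L^k + t` for `t < L^k`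
(no wrap-around: `y_μ·L^k + t < |T^{(0)}|`). [cite: Balaban1984PropagatorsI, (1.6) p.18] -/
theorem val_update_box {k : ℕ} (hk : k ≤ P.m + P.K) (y : Site P k) (z : Site P 0) (μ : Fin P.d)
    (hz : (z μ).val = (y μ).val * P.L ^ k + (P.L ^ k - 1) / 2) (t : Fin (P.L ^ k)) :
    ((Function.update z μ (z μ + (((t : ℕ) : ZMod (P.sitesPerDir 0)) - ((((P.L ^ k - 1) / 2 : ℕ)) : ZMod (P.sitesPerDir 0))))) μ).val = (y μ).val * P.L ^ k + (t : ℕ) := by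
  rw [Function.update_self]
  have e : z μ + (((t : ℕ) : ZMod (P.sitesPerDir 0)) - ((((P.L ^ k - 1) / 2 : ℕ)) : ZMod (P.sitesPerDir 0))) = ((((y μ).val * P.L ^ k + (t : ℕ) : ℕ)) : ZMod (P.sitesPerDir 0)) := by
    rw [← ZMod.natCast_zmod_val (z μ), hz]; push_cast; ring
  rw [e, ZMod.val_natCast, Nat.mod_eq_of_lt]
  have hN : P.L ^ k * P.sitesPerDir k = P.sitesPerDir 0 := by
    unfold Params.sitesPerDir; rw [Nat.sub_zero, mul_left_comm, ← pow_add, Nat.add_sub_cancel' hk]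
  have hy : (y μ).val < P.sitesPerDir k := ZMod.val_lt (y μ)
  have ht : (t : ℕ) < P.L ^ k := t.isLt
  calc (y μ).val * P.L ^ k + (t : ℕ) < (y μ).val * P.L ^ k + P.L ^ k := by omega
    _ = ((y μ).val + 1) * P.L ^ k := by ring
    _ ≤ P.sitesPerDir k * P.L ^ k := Nat.mul_le_mul_right _ hy
    _ = P.sitesPerDir 0 := by rw [mul_comm, hN]

/-- the box fold of `f ∘ iterBlockOf k` at a point `z` of the cube over `y` which is CENTRED in the coordinates still to be summed
equals `(L^k)^{|l|}·f y`: every summand is `f y` (list induction; `l` without repetitions). [cite: Balaban1984PropagatorsI, (1.18) p.20] -/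
theorem foldr_box_centre {k : ℕ} (hk : k ≤ P.m + P.K) (f : Site P k → ℝ) (y : Site P k) :
    ∀ (l : List (Fin P.d)), l.Nodup → ∀ z : Site P 0, (∀ ν, (z ν).val / P.L ^ k = (y ν).val) →
      (∀ ν ∈ l, (z ν).val = (y ν).val * P.L ^ k + (P.L ^ k - 1) / 2) →
      (List.foldr (fun (μ : Fin P.d) (w : Site P 0 → ℝ) (x : Site P 0) => ∑ t : Fin (P.L ^ k), w (Function.update x μ (x μ + (((t : ℕ) : ZMod (P.sitesPerDir 0)) - ((((P.L ^ k - 1) / 2 : ℕ)) : ZMod (P.sitesPerDir 0)))))) (fun x => f (iterBlockOf k x)) l) z = (((P.L ^ k : ℕ) : ℝ)) ^ l.length * f y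
  | [], _, z, hdiv, _ => by
    have hz : iterBlockOf k z = y := (mem_iterBlock k y z).mp ((mem_iterBlock_iff hk y z).mpr hdiv)
    simp [hz]
  | μ :: l, hnd, z, hdiv, hctr => by
    obtain ⟨hμl, hl⟩ := List.nodup_cons.mp hnd
    simp only [List.foldr_cons, List.length_cons, pow_succ]
    have key : ∀ t : Fin (P.L ^ k), (List.foldr (fun (μ : Fin P.d) (w : Site P 0 → ℝ) (x : Site P 0) => ∑ t : Fin (P.L ^ k), w (Function.update x μ (x μ + (((t : ℕ) : ZMod (P.sitesPerDir 0)) - ((((P.L ^ k - 1) / 2 : ℕ)) : ZMod (P.sitesPerDir 0)))))) (fun x => f (iterBlockOf k x)) l) (Function.update z μ (z μ + (((t : ℕ) : ZMod (P.sitesPerDir 0)) - ((((P.L ^ k - 1) / 2 : ℕ)) : ZMod (P.sitesPerDir 0))))) = (((P.L ^ k : ℕ) : ℝ)) ^ l.length * f y := by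
      intro t
      refine foldr_box_centre hk f y l hl _ (fun ν => ?_) (fun ν hν => ?_)
      · by_cases hν : ν = μ
        · subst hν
          rw [val_update_box hk y z ν (hctr ν (by simp)) t, add_comm, Nat.add_mul_div_right _ _ (pow_pos P.L_pos k),
            Nat.div_eq_of_lt t.isLt, zero_add]
        · rw [Function.update_of_ne hν]; exact hdiv ν
      · have hne : ν ≠ μ := fun e => hμl (e ▸ hν)
        rw [Function.update_of_ne hne]; exact hctr ν (by simp [hν])
    rw [Finset.sum_congr rfl (fun t _ => key t), Finset.sum_const, Finset.card_univ, Fintype.card_fin, nsmul_eq_mul]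
    ring

/-- **interpolation**: the box fold of `f ∘ iterBlockOf k` at the centre `embIter k y` is `(L^k)^d·f y` — the box of side `L^k` anchored at
`embIter k y − ((L^k−1)/2)·𝟙` is exactly the block `B^k(y)`. [cite: Balaban1984PropagatorsI, (1.18) p.20] -/
theorem foldr_box_embIter {k : ℕ} (hk : k ≤ P.m + P.K) (f : Site P k → ℝ) (y : Site P k) :
    (List.foldr (fun (μ : Fin P.d) (w : Site P 0 → ℝ) (x : Site P 0) => ∑ t : Fin (P.L ^ k), w (Function.update x μ (x μ + (((t : ℕ) : ZMod (P.sitesPerDir 0)) - ((((P.L ^ k - 1) / 2 : ℕ)) : ZMod (P.sitesPerDir 0)))))) (fun x => f (iterBlockOf k x)) (List.finRange P.d)) (embIter k y) = (((P.L ^ k : ℕ) : ℝ)) ^ P.d * f y := by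
  have h := foldr_box_centre hk f y (List.finRange P.d) (List.nodup_finRange P.d) (embIter k y)
    (fun ν => B14.Eq213DetSet.val_embIter_div hk y ν) (fun ν _ => val_embIter hk y ν)
  rwa [List.length_finRange] at h

end Centre

/-! ## §5 Energy: `Σ_b (∂ψ)(b)² ≤ (L^k)^{d−2}·Σ_c (∂f)(c)²` and the assembled interpolant -/

section Energy

open B5Eq118OneStroke (iterBlockOf)
open B15DeterminingSets (embIter)

/-- per direction: the forward difference of the full box fold is the fold, over the OTHER directions, of the long difference
`v(· + ℓe_μ) − v` (telescoping), so its square sum is at most `(ℓ²)^{d−1}·Σ_x (v(x+ℓe_μ) − v(x))²`. [folklore] -/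
theorem sum_sq_foldr_shift_sub_le (ℓ : ℕ) (h : ZMod (P.sitesPerDir 0)) (μ : Fin P.d) (v : Site P 0 → ℝ) :
    ∑ x : Site P 0, ((List.foldr (fun (μ : Fin P.d) (w : Site P 0 → ℝ) (x : Site P 0) => ∑ t : Fin ℓ, w (Function.update x μ (x μ + (((t : ℕ) : ZMod (P.sitesPerDir 0)) - h)))) v (List.finRange P.d)) (x.shift μ) - (List.foldr (fun (μ : Fin P.d) (w : Site P 0 → ℝ) (x : Site P 0) => ∑ t : Fin ℓ, w (Function.update x μ (x μ + (((t : ℕ) : ZMod (P.sitesPerDir 0)) - h)))) v (List.finRange P.d)) x) ^ 2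
      ≤ (((ℓ : ℝ)) ^ 2) ^ (P.d - 1) * ∑ x : Site P 0, (v (Function.update x μ (x μ + ((ℓ : ℕ) : ZMod (P.sitesPerDir 0)))) - v x) ^ 2 := by
  have hμ : μ ∈ List.finRange P.d := List.mem_finRange μ
  have hlen : ((List.finRange P.d).erase μ).length = P.d - 1 := by
    rw [List.length_erase_of_mem hμ, List.length_finRange]
  have hpt : ∀ x : Site P 0, (List.foldr (fun (μ : Fin P.d) (w : Site P 0 → ℝ) (x : Site P 0) => ∑ t : Fin ℓ, w (Function.update x μ (x μ + (((t : ℕ) : ZMod (P.sitesPerDir 0)) - h)))) v (List.finRange P.d)) (x.shift μ) - (List.foldr (fun (μ : Fin P.d) (w : Site P 0 → ℝ) (x : Site P 0) => ∑ t : Fin ℓ, w (Function.update x μ (x μ + (((t : ℕ) : ZMod (P.sitesPerDir 0)) - h)))) v (List.finRange P.d)) x =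
      (List.foldr (fun (μ : Fin P.d) (w : Site P 0 → ℝ) (x : Site P 0) => ∑ t : Fin ℓ, w (Function.update x μ (x μ + (((t : ℕ) : ZMod (P.sitesPerDir 0)) - h)))) (fun z => v (Function.update z μ (z μ + (((ℓ : ℕ) : ZMod (P.sitesPerDir 0)) - h))) - v (Function.update z μ (z μ + ((0 : ZMod (P.sitesPerDir 0)) - h)))) ((List.finRange P.d).erase μ)) x := by
    intro x
    rw [shift_eq_update, foldr_eq_boxStep_erase ℓ h _ μ hμ v (Function.update x μ (x μ + 1)), foldr_eq_boxStep_erase ℓ h _ μ hμ v x]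
    simp only [update_update_add]
    rw [← Finset.sum_sub_distrib]
    have e : ∀ t : Fin ℓ, (1 : ZMod (P.sitesPerDir 0)) + ((((t : ℕ) : ZMod (P.sitesPerDir 0))) - h) = (((t : ℕ) : ZMod (P.sitesPerDir 0))) - h + 1 := fun t => by ring
    simp only [e]
    rw [boxSum_diff ℓ h μ, foldr_translate ℓ h _ μ _ v x, foldr_translate ℓ h _ μ _ v x, ← foldr_sub]
  simp only [hpt]
  refine (sum_sq_foldr_le ℓ h _ _).trans (le_of_eq ?_)
  rw [hlen]
  congr 1
  rw [← sum_translate μ ((0 : ZMod (P.sitesPerDir 0)) - h) (fun z => (v (Function.update z μ (z μ + ((ℓ : ℕ) : ZMod (P.sitesPerDir 0)))) - v z) ^ 2)]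
  refine Finset.sum_congr rfl fun x _ => ?_
  rw [update_update_add, show (0 : ZMod (P.sitesPerDir 0)) - h + ((ℓ : ℕ) : ZMod (P.sitesPerDir 0)) = ((ℓ : ℕ) : ZMod (P.sitesPerDir 0)) - h by ring]

/-- per direction, for `v = f ∘ iterBlockOf k` and `ℓ = L^k`: the long difference is a difference of `f` across one bond of `T^{(k)}`
(`iterBlockOf_update_pow`), counted `L^{kd}` times (`sum_comp_iterBlockOf`). [cite: Balaban1984PropagatorsI, (1.18) p.20] -/
theorem sum_sq_foldr_shift_sub_le_coarse {k : ℕ} (hk : k ≤ P.m + P.K) (f : Site P k → ℝ) (μ : Fin P.d) :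
    ∑ x : Site P 0, ((List.foldr (fun (μ : Fin P.d) (w : Site P 0 → ℝ) (x : Site P 0) => ∑ t : Fin (P.L ^ k), w (Function.update x μ (x μ + (((t : ℕ) : ZMod (P.sitesPerDir 0)) - ((((P.L ^ k - 1) / 2 : ℕ)) : ZMod (P.sitesPerDir 0)))))) (fun x => f (iterBlockOf k x)) (List.finRange P.d)) (x.shift μ) - (List.foldr (fun (μ : Fin P.d) (w : Site P 0 → ℝ) (x : Site P 0) => ∑ t : Fin (P.L ^ k), w (Function.update x μ (x μ + (((t : ℕ) : ZMod (P.sitesPerDir 0)) - ((((P.L ^ k - 1) / 2 : ℕ)) : ZMod (P.sitesPerDir 0)))))) (fun x => f (iterBlockOf k x)) (List.finRange P.d)) x) ^ 2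
      ≤ ((((P.L ^ k : ℕ) : ℝ)) ^ 2) ^ (P.d - 1) * ((((P.L ^ P.d) ^ k : ℕ) : ℝ) * ∑ y : Site P k, (f (y.shift μ) - f y) ^ 2) := by
  refine (sum_sq_foldr_shift_sub_le (P.L ^ k) _ μ _).trans (le_of_eq ?_)
  congr 1
  rw [← sum_comp_iterBlockOf hk (fun y => (f (y.shift μ) - f y) ^ 2)]
  refine Finset.sum_congr rfl fun x _ => ?_
  rw [iterBlockOf_update_pow hk x μ]

/-- the constant: `(1/ℓ^d)²·(ℓ²)^{d−1}·ℓ^d = ℓ^d/ℓ² ≤ ℓ^{d−2}` (`ℓ ≥ 1`, `d ≥ 1`; truncated subtraction on the right). [folklore] -/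
theorem tent_const_le {d : ℕ} (hd : 1 ≤ d) {ℓ : ℝ} (hℓ : 1 ≤ ℓ) :
    (1 / ℓ ^ d) ^ 2 * ((ℓ ^ 2) ^ (d - 1) * ℓ ^ d) ≤ ℓ ^ (d - 2) := by
  have hℓ0 : 0 < ℓ := by linarith
  obtain ⟨e, rfl⟩ : ∃ e, d = e + 1 := ⟨d - 1, by omega⟩
  have h1 : (1 / ℓ ^ (e + 1)) ^ 2 * ((ℓ ^ 2) ^ (e + 1 - 1) * ℓ ^ (e + 1)) = ℓ ^ (e + 1) / ℓ ^ 2 := by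
    rw [Nat.add_sub_cancel]; field_simp; ring
  rw [h1, div_le_iff₀ (by positivity), ← pow_add]
  exact pow_le_pow_right₀ hℓ (by omega)

/-- **N4 — TENT ∕ BOX-FILTER INTERPOLATION** (CARD-19200-V3-g11 §2, stub (P) of route R): every function `f` on the `k`-th lattice
`T^{(k)}` has an extension `ψ` to the finest torus `T^{(0)}` — `ψ = f` at the centres `embIter k y` — whose Dirichlet energy is at most
`(L^k)^{d−2}` times that of `f`: `ψ(x) = (L^k)^{-d}·Σ_{z ∈ x + [−(L^k−1)/2, (L^k−1)/2]^d} f(B^k(z))` (the `d`-fold box filter of the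
block-constant extension; def-free: written as a `List.foldr` of one-dimensional box sums). For `d = 3`, `k = K − n` this is the
`L^{K−n}`-Lipschitz tent of the CARD. [cite: Balaban1984PropagatorsI, (1.18) p.20] -/
theorem exists_tentInterpolant (k : ℕ) (hk : k ≤ P.m + P.K) (f : Site P k → ℝ) :
    ∃ ψ : Site P 0 → ℝ, (∀ y : Site P k, ψ (embIter k y) = f y) ∧
      ∑ b : PBond P 0, (ψ b.tgt - ψ b.src) ^ 2 ≤ ((P.L : ℝ) ^ k) ^ (P.d - 2) * ∑ b : PBond P k, (f b.tgt - f b.src) ^ 2 := by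
  have hℓ1 : (1 : ℝ) ≤ ((P.L ^ k : ℕ) : ℝ) := by exact_mod_cast Nat.one_le_pow _ _ P.L_pos
  have hℓ0 : ((P.L ^ k : ℕ) : ℝ) ≠ 0 := by positivity
  refine ⟨fun x => (1 / (((P.L ^ k : ℕ) : ℝ)) ^ P.d) * (List.foldr (fun (μ : Fin P.d) (w : Site P 0 → ℝ) (x : Site P 0) => ∑ t : Fin (P.L ^ k), w (Function.update x μ (x μ + (((t : ℕ) : ZMod (P.sitesPerDir 0)) - ((((P.L ^ k - 1) / 2 : ℕ)) : ZMod (P.sitesPerDir 0)))))) (fun x => f (iterBlockOf k x)) (List.finRange P.d)) x, fun y => ?_, ?_⟩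
  · beta_reduce
    rw [foldr_box_embIter hk f y, one_div, inv_mul_cancel_left₀ (pow_ne_zero _ hℓ0)]
  · rw [B10StarCount.sum_pbond, B10StarCount.sum_pbond]
    simp only [PBond.tgt, ← mul_sub, mul_pow, ← Finset.mul_sum]
    calc (1 / (((P.L ^ k : ℕ) : ℝ)) ^ P.d) ^ 2 * ∑ x : Site P 0, ∑ μ : Fin P.d, ((List.foldr (fun (μ : Fin P.d) (w : Site P 0 → ℝ) (x : Site P 0) => ∑ t : Fin (P.L ^ k), w (Function.update x μ (x μ + (((t : ℕ) : ZMod (P.sitesPerDir 0)) - ((((P.L ^ k - 1) / 2 : ℕ)) : ZMod (P.sitesPerDir 0)))))) (fun x => f (iterBlockOf k x)) (List.finRange P.d)) (x.shift μ) - (List.foldr (fun (μ : Fin P.d) (w : Site P 0 → ℝ) (x : Site P 0) => ∑ t : Fin (P.L ^ k), w (Function.update x μ (x μ + (((t : ℕ) : ZMod (P.sitesPerDir 0)) - ((((P.L ^ k - 1) / 2 : ℕ)) : ZMod (P.sitesPerDir 0)))))) (fun x => f (iterBlockOf k x)) (List.finRange P.d)) x) ^ 2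
        = (1 / (((P.L ^ k : ℕ) : ℝ)) ^ P.d) ^ 2 * ∑ μ : Fin P.d, ∑ x : Site P 0, ((List.foldr (fun (μ : Fin P.d) (w : Site P 0 → ℝ) (x : Site P 0) => ∑ t : Fin (P.L ^ k), w (Function.update x μ (x μ + (((t : ℕ) : ZMod (P.sitesPerDir 0)) - ((((P.L ^ k - 1) / 2 : ℕ)) : ZMod (P.sitesPerDir 0)))))) (fun x => f (iterBlockOf k x)) (List.finRange P.d)) (x.shift μ) - (List.foldr (fun (μ : Fin P.d) (w : Site P 0 → ℝ) (x : Site P 0) => ∑ t : Fin (P.L ^ k), w (Function.update x μ (x μ + (((t : ℕ) : ZMod (P.sitesPerDir 0)) - ((((P.L ^ k - 1) / 2 : ℕ)) : ZMod (P.sitesPerDir 0)))))) (fun x => f (iterBlockOf k x)) (List.finRange P.d)) x) ^ 2 := by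
          rw [Finset.sum_comm]
      _ ≤ (1 / (((P.L ^ k : ℕ) : ℝ)) ^ P.d) ^ 2 * ∑ μ : Fin P.d, (((((P.L ^ k : ℕ) : ℝ)) ^ 2) ^ (P.d - 1) * ((((P.L ^ P.d) ^ k : ℕ) : ℝ) * ∑ y : Site P k, (f (y.shift μ) - f y) ^ 2)) :=
          mul_le_mul_of_nonneg_left (Finset.sum_le_sum fun μ _ => sum_sq_foldr_shift_sub_le_coarse hk f μ) (sq_nonneg _)
      _ = ((1 / (((P.L ^ k : ℕ) : ℝ)) ^ P.d) ^ 2 * (((((P.L ^ k : ℕ) : ℝ)) ^ 2) ^ (P.d - 1) * (((P.L ^ k : ℕ) : ℝ)) ^ P.d)) * ∑ y : Site P k, ∑ μ : Fin P.d, (f (y.shift μ) - f y) ^ 2 := by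
          rw [← Finset.mul_sum, ← Finset.mul_sum, Finset.sum_comm]; push_cast; ring
      _ ≤ ((P.L : ℝ) ^ k) ^ (P.d - 2) * ∑ y : Site P k, ∑ μ : Fin P.d, (f (y.shift μ) - f y) ^ 2 := by
          refine mul_le_mul_of_nonneg_right ?_ (Finset.sum_nonneg fun y _ => Finset.sum_nonneg fun μ _ => sq_nonneg _)
          have hc := tent_const_le P.hd hℓ1
          push_cast at hc ⊢
          exact hc

/-- the same with the gradients `LatticeFieldCalculus.grad c` (any common factor `c`) on both levels — the form consumed by
`Prop7PinnedHodgeSplit.sum_grad_sq_le_of_eq_on_support`. [cite: Balaban1984PropagatorsI, (1.4) p.18] -/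
theorem exists_tentInterpolant_grad (k : ℕ) (hk : k ≤ P.m + P.K) (c : ℝ) (f : Site P k → ℝ) :
    ∃ ψ : Site P 0 → ℝ, (∀ y : Site P k, ψ (embIter k y) = f y) ∧
      ∑ b : PBond P 0, (LatticeFieldCalculus.grad c ψ b) ^ 2 ≤ ((P.L : ℝ) ^ k) ^ (P.d - 2) * ∑ b : PBond P k, (LatticeFieldCalculus.grad c f b) ^ 2 := by
  obtain ⟨ψ, h1, h2⟩ := exists_tentInterpolant k hk f
  refine ⟨ψ, h1, ?_⟩
  simp only [LatticeFieldCalculus.grad, smul_eq_mul, mul_pow, ← Finset.mul_sum]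
  rw [mul_left_comm]
  exact mul_le_mul_of_nonneg_left h2 (sq_nonneg c)

end Energy

end Summit.QuantumFields.YangMills.Theorems.Prop7TentInterpolation

end
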